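import Summits.HodgeConjecture.HodgeConjecture.Theorems.VHCAbelianSchemesRoadSecantQuotientPinnedOwnChartDefs
import Literature.AlgebraicGeometry.HodgeTheory.SecantQuotientJacobianTwistedCarrierForall
import HarnessLib

/-!
# Road №4 (`VHCAbelianSchemesRoad`) — THE REPAIRED NODE (P2♭): Weil-plane rigidity of the pinned served set AT NON-HYPERELLIPTIC, H-GOOD,
# `End`-TRIVIAL secant–quotient data (director-hodge g14 R14.38 (1): «repair of record C′ = End-triviality»)

research route conditional on HC_CM; not a corollary; Q11.4-sentence-2 already refuted in dim ≥ 3.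

DEFINITIONS ONLY (drafted by ring2 LEAD 163 = typer1 seat for a prover's hands; `HC_CM` nowhere; nothing asserted). WHY THIS NODE EXISTS. The node
(P2) `SecantQuotientPinnedWeilPlaneRigidity` (p641318, `…Theorems.VHCAbelianSchemesRoadSecantQuotientPinnedOwnChartDefs`) quantifies over ALL
secant–quotient data. refute-markman g7's kernel NEGATIVE LEMMA (p645590, `…Theorems/SecantQuotientPinnedWeilPlaneRigidity/Negative/
SecantQuotientPinnedWeilPlaneRigidityFalseOfWeilPlaneMovingLevelSymmetry.lean`: `WeilPlaneMovingLevelSymmetryExists → ¬ SecantQuotientPinnedWeilPlaneRigidity`,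
with the H-free core `not_rigidityAtHGood_of_intertwiner`) shows that (P2) FAILS at every `Aut`-symmetric datum: for a bielliptic non-hyperelliptic genus-3
curve with involution `σ` and level groups in the Prym surface's torsion, `β = (−σ) × 1_Ĵ` preserves `Ḡ` and the polarisation but conjugates `φ_d`
OUT of `±`(the `ℚ(φ_d)`-line), so transport of structure serves rational classes `β̄^*γ ∉ W(D)` (named instance: W9 RESULT B, `y⁴ = x(x−1)(x−3)`, `d = 4`;
`H = WeilPlaneMovingLevelSymmetryExists` filed for construction, open clause (U1) = general position of the translates). The director's ruling R14.38 (1):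
(P2) is REFUTED-MISSTATED-IF-LANDED and the REPAIR OF RECORD is the same statement KEYED BY `End`-TRIVIALITY of the presenting Jacobian —
`∀ f : J ⟶ J, ∃ n : ℤ, f = n • 𝟙 J` — which the bielliptic witness misses (it has `σ ∈ Aut J`), and which is where print's anchor lives (a very general
curve in the irreducible level family has `End J = ℤ`). «Exclude CM» is NOT the repair (the witness is not CM in general). The refuted-modulo decl (P2)
STAYS in the tree as the settled negative edge; this file adds the repaired node next to it:

* (P2♭) `SecantQuotientPinnedWeilPlaneRigidityOfEndTrivial` — for every datum `D` presented by a NON-HYPERELLIPTIC curve with print's standing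
  hypothesis `OrbitTranslatesDisjoint D.𝒥 D.G₁ D.G₂` (refute-markman WAKE #8) and with `End J = ℤ·1`, and every polarisation class `θ₀` of `Θ`, every
  class pinned-served at `(D.Y.X, h_Y(θ₀))` — through WHATEVER presentation — pulls back under `D`'s own `q` into `D`'s own Weil plane
  `weilClassesOf D.P D.ψ 3 D.d`. The statement is LITERALLY the registered child (c3″) `stub_pinnedWeilPlaneRigidity_offHypDisjEnd` of crux
  stmt-HodgeConjecture-26512 (skeleton v3.12, `Cruxes/DiagLocalOfMarkmanPinnedForall/Lines/birth.lean`), so a proof of (P2♭) closes (c3″) by `Iff.rfl`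
  (`secantQuotientPinnedWeilPlaneRigidityOfEndTrivial_iff`). WHY IT SHOULD HOLD (ring2-b03x g15 item (i), `…_of_endRingInt`): with `End J = ℤ` one has
  `End⁰(J × Ĵ) = M₂(ℚ)` with the Rosati involution of `diag(1, d)`; its antisymmetric part is the line `ℚψ`, so every intertwiner `β` of a second
  presentation satisfies `β^*φ_d ∈ ±ℚ^×φ_d` and carries the Weil plane onto itself (the plane is symmetric under `φ_d ↦ −φ_d`); the polarisation type of
  `h_Y` fixes `d' = d`. IN-HOUSE, NOT IN PRINT. WHY IT MIGHT FAIL: only print-level residue — the hyperbolicity ∕ ample-line clauses of `𝔖^pin` at the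
  second presentation (Markman Lemma 3.1.3, Cor. 3.2.3), or a (U1)-type general-position failure shrinking the anchor family (density unaffected). The two
  extra keys `¬ IsHyperelliptic`, `OrbitTranslatesDisjoint` are the line's anchor keys since v3.7 ∕ v3.10 (they do not bear on rigidity; they are kept so
  that (P2♭) is (c3″) on the nose). A HYPOTHESIS wherever used; refuter target.

Also: the unfolding lemma `_iff` and the trivial edge `…_of_rigidity : SecantQuotientPinnedWeilPlaneRigidity → (P2♭)` (the refuted-modulo node implies
the repaired one; recorded so that refuters see the direction of the repair — NOT a way to prove (P2♭)).

NOT CLAIMED: (P2♭), (P2), (P1), any stub, 2m″, 26512, 26511, 23176, `HC_AV`, `HC_CM` or HC; HC_CM HELD, by name only; typed ≠ proved.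
References: [cite: Markman2025SecantWeil, §1.3 (p. 5), §1.5 (p. 7), Thm. 1.4.1 (item 4), §3.1 Lemma 3.1.3 and §3.2 Cor. 3.2.3]
[cite: MoonenZarhin1998WeilClasses, §1 (dim_K W_K = 1)] [cite: vanGeemen1994HodgeAV, 4.9 and Lemma 5.2] [cite: MumfordAV1970, §19–§21 (Rosati involution,
`End⁰` of a product)] [cite: Deligne1982HodgeCycles, §4 (4.3)–Prop. 4.4].
-/

open CategoryTheory CategoryTheory.Limits AlgebraicGeometry Topology

namespace Summit.HodgeConjecture.HodgeConjecture.Ring2.SemiregularRepresentatives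

set_option linter.dupNamespace false -- the cell's namespace repeats the summit name, as in every `Ring2*` file

open Literature.AlgebraicGeometry Literature.AlgebraicGeometry.Motives Literature.AlgebraicGeometry.Motives.AbelianVariety
open Literature.AlgebraicGeometry.HodgeTheory Literature.AlgebraicGeometry.Markman2025
open Literature.AlgebraicTopology.SingularHomology

/-- **(P2♭) WEIL-PLANE RIGIDITY OF THE PINNED SERVED SET AT NON-HYPERELLIPTIC, H-GOOD, `End`-TRIVIAL DATA**
(`SecantQuotientPinnedWeilPlaneRigidityOfEndTrivial`; director-hodge g14 R14.38 (1): the repair of record of (P2) `SecantQuotientPinnedWeilPlaneRigidity`,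
which refute-markman g7's negative lemma p645590 refutes modulo `WeilPlaneMovingLevelSymmetryExists` at `Aut`-symmetric data): for every secant–quotient
datum `D` with `¬ D.𝒥.IsHyperelliptic`, `OrbitTranslatesDisjoint D.𝒥 D.G₁ D.G₂` and `∀ f : D.𝒥.J ⟶ D.𝒥.J, ∃ n : ℤ, f = n • 𝟙 D.𝒥.J`, and every polarisation
class `θ₀` of `Θ`, every class pinned-served at `(D.Y.X, h_Y(θ₀))` has `q^*γ ∈ weilClassesOf D.P D.ψ 3 D.d`. LITERALLY the registered child (c3″)
`stub_pinnedWeilPlaneRigidity_offHypDisjEnd` of crux stmt-HodgeConjecture-26512 (skeleton v3.12). IN-HOUSE, not in print; expected from `End⁰(J × Ĵ) = M₂(ℚ)`,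
Rosati-antisymmetric part `= ℚψ` (ring2-b03x g15 item (i)). Why it might fail: print-level clauses of `𝔖^pin` at a second presentation (Markman Lemma 3.1.3,
Cor. 3.2.3). A HYPOTHESIS wherever used; refuter target. [cite: Markman2025SecantWeil, Thm. 1.4.1 (item 4), §1.3 (p. 5) and §1.5 (p. 7)]
[cite: MoonenZarhin1998WeilClasses, §1] [cite: MumfordAV1970, §19–§21] -/
@[conjecture] def SecantQuotientPinnedWeilPlaneRigidityOfEndTrivial : Prop :=
  ∀ (D : SecantQuotientDatum) (θ₀ : complexBetti D.𝒥.J.X 2),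
    ¬ D.𝒥.IsHyperelliptic → OrbitTranslatesDisjoint D.𝒥 D.G₁ D.G₂ → D.𝒥.J.IsPolarizationClassOf D.Θ θ₀ →
    (∀ f : D.𝒥.J ⟶ D.𝒥.J, ∃ n : ℤ, f = n • 𝟙 D.𝒥.J) →
    ∀ γ ∈ secantQuotientServedClassesPinned D.Y.X (D.hY θ₀),
      complexBetti.map D.q.hom.hom.hom (2 * 3) γ ∈ weilClassesOf D.P D.ψ 3 D.d

/-- (P2♭) unfolded (definitional) — the right-hand side is the registered statement of (c3″) `stub_pinnedWeilPlaneRigidity_offHypDisjEnd`.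
[cite: Markman2025SecantWeil, Thm. 1.4.1 (item 4)] -/
theorem secantQuotientPinnedWeilPlaneRigidityOfEndTrivial_iff :
    SecantQuotientPinnedWeilPlaneRigidityOfEndTrivial ↔
      ∀ (D : SecantQuotientDatum) (θ₀ : complexBetti D.𝒥.J.X 2),
        ¬ D.𝒥.IsHyperelliptic → OrbitTranslatesDisjoint D.𝒥 D.G₁ D.G₂ → D.𝒥.J.IsPolarizationClassOf D.Θ θ₀ →
        (∀ f : D.𝒥.J ⟶ D.𝒥.J, ∃ n : ℤ, f = n • 𝟙 D.𝒥.J) →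
        ∀ γ ∈ secantQuotientServedClassesPinned D.Y.X (D.hY θ₀),
          complexBetti.map D.q.hom.hom.hom (2 * 3) γ ∈ weilClassesOf D.P D.ψ 3 D.d :=
  Iff.rfl

/-- The trivial edge of the repair: the (refuted-modulo-`H`) node (P2) over ALL data implies the repaired node (P2♭) — recorded for the refuters' map of
the repair direction only; NOT a way to prove (P2♭). [cite: Markman2025SecantWeil, Thm. 1.4.1 (item 4)] -/
theorem secantQuotientPinnedWeilPlaneRigidityOfEndTrivial_of_rigidity (h : SecantQuotientPinnedWeilPlaneRigidity) :
    SecantQuotientPinnedWeilPlaneRigidityOfEndTrivial :=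
  fun D θ₀ _ _ hθ₀ _ γ hγ => h D θ₀ hθ₀ γ hγ

end Summit.HodgeConjecture.HodgeConjecture.Ring2.SemiregularRepresentatives
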